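import Summits.RiemannHypothesis.RiemannHypothesis.Theorems.JensenPolynomialsSkewFarSystemTwo

/-!
# Route `JensenPolynomials`, FAR crux `XiCumulantSkew98Far` — part 4a: the normalised Stein system and its numeric inputs
(RH-FREE; cell rh-jensen, HUMAN RULING D-0040)

With `s ≥ 4·10¹⁸`, `a = a_s`, `Z = M_s`, `x_n := I_n/Z` (odd `n`), `z_n := I_{2n}/Z`, `l := a/√s`: the a-priori bounds
`z_n ≤ (2n−1)‼ l^{2n}` (`z_bounds`), the four error-equations of parts 3a/3b divided by `Z` (`normalized_system`), the sizes
`R ≤ 4.11a/l²`, `c ≤ 8.22a/l²`, `C₃ ≤ 15.01a/l²`, `1.94 ≤ c/R ≤ 2` (`const_sizes`) and the numeric monomial bounds in `l`,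
`a·l` (`monomials`). Part 4b (`…SkewFarSolve.lean`) solves the system.
WHAT THIS IS NOT: nothing here bears on the zeros of `ζ`. References: Stein's method (folklore); [CoffeyCsordas2013]; [GORZPNAS2019].
-/

noncomputable section
-- D-0017: `Summit.RiemannHypothesis.RiemannHypothesis.…` duplicates the namespace BY DESIGN (single-problem summit).
set_option linter.dupNamespace false

namespace Summit.RiemannHypothesis.RiemannHypothesis.Theorems.JensenPolynomials.SkewFar

open Literature.NumberTheory.LFunctions Literature.Probability.Distributions MeasureTheory Set Filter Real
open scoped Topology Nat

/-- The a-priori bounds on the normalised even moments `z_n = I_{2n}/Z`, `n ≤ 5`, with `l = a/√s`: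
`0 ≤ z_n`, `z₁ ≤ l²`, `z₂ ≤ 3l⁴`, `z₃ ≤ 15l⁶`, `z₄ ≤ 105l⁸`, `z₅ ≤ 945l¹⁰`. -/
theorem z_bounds (s : ℕ) (hs : 4 * 10 ^ 18 ≤ s) {l z₁ z₂ z₃ z₄ z₅ : ℝ} (hl : l = xiMode (s : ℝ) / Real.sqrt s)
    (h₁ : z₁ = xiAbsMoment s 2 (xiMode (s : ℝ)) / xiMoment s) (h₂ : z₂ = xiAbsMoment s 4 (xiMode (s : ℝ)) / xiMoment s)
    (h₃ : z₃ = xiAbsMoment s 6 (xiMode (s : ℝ)) / xiMoment s) (h₄ : z₄ = xiAbsMoment s 8 (xiMode (s : ℝ)) / xiMoment s)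
    (h₅ : z₅ = xiAbsMoment s 10 (xiMode (s : ℝ)) / xiMoment s) :
    (0 ≤ z₁ ∧ 0 ≤ z₂ ∧ 0 ≤ z₃ ∧ 0 ≤ z₄ ∧ 0 ≤ z₅) ∧
      z₁ ≤ l ^ 2 ∧ z₂ ≤ 3 * l ^ 4 ∧ z₃ ≤ 15 * l ^ 6 ∧ z₄ ≤ 105 * l ^ 8 ∧ z₅ ≤ 945 * l ^ 10 := by
  have hZ := xiMoment_pos s
  have hnn : ∀ n, 0 ≤ xiAbsMoment s n (xiMode (s : ℝ)) / xiMoment s := fun n =>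
    div_nonneg (setIntegral_nonneg measurableSet_Ioi fun u hu =>
      mul_nonneg (mul_pos (deBruijnPhi_pos_holds u) (pow_pos hu s)).le (by positivity)) hZ.le
  refine ⟨⟨h₁ ▸ hnn 2, h₂ ▸ hnn 4, h₃ ▸ hnn 6, h₄ ▸ hnn 8, h₅ ▸ hnn 10⟩, ?_, ?_, ?_, ?_, ?_⟩
  · have h := z_le s hs hl 1
    have e : ((2 * 1 - 1)‼ : ℕ) = 1 := by decide
    rw [e] at h; norm_num at h; rw [h₁]; exact h
  · have h := z_le s hs hl 2
    have e : ((2 * 2 - 1)‼ : ℕ) = 3 := by decide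
    rw [e] at h; norm_num at h; rw [h₂]; exact h
  · have h := z_le s hs hl 3
    have e : ((2 * 3 - 1)‼ : ℕ) = 15 := by decide
    rw [e] at h; norm_num at h; rw [h₃]; exact h
  · have h := z_le s hs hl 4
    have e : ((2 * 4 - 1)‼ : ℕ) = 105 := by decide
    rw [e] at h; norm_num at h; rw [h₄]; exact h
  · have h := z_le s hs hl 5
    have e : ((2 * 5 - 1)‼ : ℕ) = 945 := by decide
    rw [e] at h; norm_num at h; rw [h₅]; exact h

/-- **The normalised Stein system**: equations 0–3 of parts 3a/3b divided by `Z = M_s`, in the normalised moments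
`x₁, x₃, x₅` (odd, signed) and `z₁, …, z₅` (even), together with the AM–GM bounds on `x₃, x₅`. -/
theorem normalized_system (s : ℕ) (hs : 4 * 10 ^ 18 ≤ s) {A R c C l x₁ x₃ x₅ z₁ z₂ z₃ z₄ z₅ : ℝ}
    (hA : A = 4 * π * exp (4 * xiMode (s : ℝ))) (hR : R = 4 * A + s / xiMode (s : ℝ) ^ 2)
    (hc : c = 8 * A - s / xiMode (s : ℝ) ^ 3) (hC : C = 15 * A + 2 * s / xiMode (s : ℝ) ^ 4) (hl : 0 < l)
    (hx₁ : x₁ = (∫ u in Ioi 0, deBruijnPhi u * u ^ s * (u - xiMode (s : ℝ))) / xiMoment s)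
    (hx₃ : x₃ = (∫ u in Ioi 0, deBruijnPhi u * u ^ s * (u - xiMode (s : ℝ)) ^ 3) / xiMoment s)
    (hx₅ : x₅ = (∫ u in Ioi 0, deBruijnPhi u * u ^ s * (u - xiMode (s : ℝ)) ^ 5) / xiMoment s)
    (h₁ : z₁ = xiAbsMoment s 2 (xiMode (s : ℝ)) / xiMoment s) (h₂ : z₂ = xiAbsMoment s 4 (xiMode (s : ℝ)) / xiMoment s)
    (h₃ : z₃ = xiAbsMoment s 6 (xiMode (s : ℝ)) / xiMoment s) (h₄ : z₄ = xiAbsMoment s 8 (xiMode (s : ℝ)) / xiMoment s)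
    (h₅ : z₅ = xiAbsMoment s 10 (xiMode (s : ℝ)) / xiMoment s) :
    |R * x₁ + c * z₁| ≤ 1 / 200 + C / 2 * (l * z₁ + z₂ / l) + 10 ^ 8 / 2 * (l * (3 * z₁) + 5 * z₂ / l) +
      10 ^ 8 * R / 2 * (l * z₂ + z₃ / l) + 10 ^ 8 * c * z₃ ∧
    |1 - R * z₁ - c * x₃| ≤ 1 / 200 / 2 * (l + z₁ / l) + C * z₂ + 5 * 10 ^ 8 * z₂ + 10 ^ 8 * R * z₃ +
      10 ^ 8 * c / 2 * (l * z₃ + z₄ / l) ∧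
    |2 * x₁ - R * x₃ - c * z₂| ≤ 1 / 200 * z₁ + C / 2 * (l * z₂ + z₃ / l) +
      10 ^ 8 / 2 * (l * (5 * z₂) + 7 * z₃ / l) + 10 ^ 8 * R / 2 * (l * z₃ + z₄ / l) + 10 ^ 8 * c * z₄ ∧
    |3 * z₁ - R * z₂ - c * x₅| ≤ 1 / 200 / 2 * (l * z₁ + z₂ / l) + C * z₃ + 7 * 10 ^ 8 * z₃ +
      10 ^ 8 * R * z₄ + 10 ^ 8 * c / 2 * (l * z₄ + z₅ / l) ∧
    |x₃| ≤ (l * z₁ + z₂ / l) / 2 ∧ |x₅| ≤ (l * z₂ + z₃ / l) / 2 := by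
  have hZ := xiMoment_pos s
  have e0 := sys0 s hs hA hR hc hC hl
  have e1 := sys1 s hs hA hR hc hC hl
  have e2 := sys2 s hs hA hR hc hC hl
  have e3 := sys3 s hs hA hR hc hC hl
  have o3 := absOddMoment_le s 1 (xiMode (s : ℝ)) hl
  have o5 := absOddMoment_le s 2 (xiMode (s : ℝ)) hl
  simp only [Nat.reduceMul, Nat.reduceAdd] at o3 o5
  have hI : ∀ {n : ℕ} {z : ℝ}, z = xiAbsMoment s n (xiMode (s : ℝ)) / xiMoment s →
      xiAbsMoment s n (xiMode (s : ℝ)) = z * xiMoment s := fun {n z} h => by rw [h]; field_simp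
  have hJ : ∀ {k : ℕ} {x : ℝ}, x = (∫ u in Ioi 0, deBruijnPhi u * u ^ s * (u - xiMode (s : ℝ)) ^ k) / xiMoment s →
      (∫ u in Ioi 0, deBruijnPhi u * u ^ s * (u - xiMode (s : ℝ)) ^ k) = x * xiMoment s := fun {k x} h => by
    rw [h]; field_simp
  have hI1 : (∫ u in Ioi 0, deBruijnPhi u * u ^ s * (u - xiMode (s : ℝ))) = x₁ * xiMoment s := by
    rw [hx₁]; field_simp
  rw [hI1, hI h₁, hI h₂, hI h₃] at e0
  rw [hI h₁, hJ hx₃, hI h₂, hI h₃, hI h₄] at e1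
  rw [hI1, hJ hx₃, hI h₂, hI h₁, hI h₃, hI h₄] at e2
  rw [hI h₁, hI h₂, hJ hx₅, hI h₃, hI h₄, hI h₅] at e3
  rw [hJ hx₃, hI h₁, hI h₂] at o3
  rw [hJ hx₅, hI h₂, hI h₃] at o5
  have divZ : ∀ {X Y : ℝ}, |X * xiMoment s| ≤ Y → |X| ≤ Y / xiMoment s := fun {X Y} h => by
    rw [abs_mul, abs_of_pos hZ] at h
    exact (le_div_iff₀ hZ).2 h
  refine ⟨?_, ?_, ?_, ?_, ?_, ?_⟩
  · rw [show R * (x₁ * xiMoment s) + c * (z₁ * xiMoment s) = (R * x₁ + c * z₁) * xiMoment s by ring] at e0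
    refine (divZ e0).trans (le_of_eq ?_)
    rw [div_eq_iff hZ.ne']
    ring
  · rw [show xiMoment s - R * (z₁ * xiMoment s) - c * (x₃ * xiMoment s) = (1 - R * z₁ - c * x₃) * xiMoment s by ring]
      at e1
    refine (divZ e1).trans (le_of_eq ?_)
    rw [div_eq_iff hZ.ne']
    ring
  · rw [show 2 * (x₁ * xiMoment s) - R * (x₃ * xiMoment s) - c * (z₂ * xiMoment s) =
      (2 * x₁ - R * x₃ - c * z₂) * xiMoment s by ring] at e2
    refine (divZ e2).trans (le_of_eq ?_)
    rw [div_eq_iff hZ.ne']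
    ring
  · rw [show 3 * (z₁ * xiMoment s) - R * (z₂ * xiMoment s) - c * (x₅ * xiMoment s) =
      (3 * z₁ - R * z₂ - c * x₅) * xiMoment s by ring] at e3
    refine (divZ e3).trans (le_of_eq ?_)
    rw [div_eq_iff hZ.ne']
    ring
  · refine (divZ o3).trans (le_of_eq ?_)
    rw [div_eq_iff hZ.ne']
    ring
  · refine (divZ o5).trans (le_of_eq ?_)
    rw [div_eq_iff hZ.ne']
    ring

/-- Sizes of the constants in units of `a/l²` (`s/a = a/l²`): `R ≤ 4.11a/l²`, `c ≤ 8.22a/l²`, `C₃ ≤ 15.01a/l²`,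
`1.94 ≤ κ = c/R ≤ 2`. -/
theorem const_sizes (s : ℕ) (hs : 4 * 10 ^ 18 ≤ s) {A R c l : ℝ} (hA : A = 4 * π * exp (4 * xiMode (s : ℝ)))
    (hR : R = 4 * A + s / xiMode (s : ℝ) ^ 2) (hc : c = 8 * A - s / xiMode (s : ℝ) ^ 3)
    (hl : l = xiMode (s : ℝ) / Real.sqrt s) :
    R ≤ 4.11 * (xiMode (s : ℝ) / l ^ 2) ∧ c ≤ 8.22 * (xiMode (s : ℝ) / l ^ 2) ∧
      15 * A + 2 * s / xiMode (s : ℝ) ^ 4 ≤ 15.01 * (xiMode (s : ℝ) / l ^ 2) ∧ 1.94 ≤ c / R ∧ c / R ≤ 2 := by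
  obtain ⟨ha0, ha, _, _⟩ := mode_facts s hs
  obtain ⟨hApos, hsaA, hAsa, hR0, hc0, hc2R, _, _⟩ := consts_facts s hs hA hR hc
  obtain ⟨hl0, hl2, _⟩ := scale_facts s hs hl
  set a := xiMode (s : ℝ) with ha_def
  have hs' : (4 * 10 ^ 18 : ℝ) ≤ (s : ℝ) := by exact_mod_cast hs
  have hspos : (0 : ℝ) < s := by linarith
  have hsa : (s : ℝ) / a = a / l ^ 2 := by rw [hl2]; field_simp
  have hsa0 : 0 < (s : ℝ) / a := div_pos hspos ha0
  have hRle : R ≤ 4.11 * (a / l ^ 2) := by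
    rw [hR, ← hsa]
    have h1 : (s : ℝ) / a ^ 2 = ((s : ℝ) / a) / a := by rw [pow_two, div_div]
    have h2 : ((s : ℝ) / a) / a ≤ ((s : ℝ) / a) / (189 / 20) := div_le_div_of_nonneg_left hsa0.le (by norm_num) ha
    rw [h1]; linarith
  refine ⟨hRle, by linarith, ?_, ?_, ?_⟩
  · rw [← hsa]
    have h1 : (s : ℝ) / a ^ 4 = ((s : ℝ) / a) / a ^ 3 := by rw [div_div, show a * a ^ 3 = a ^ 4 by ring]
    have ha3 : (843 : ℝ) ≤ a ^ 3 := by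
      have h := pow_le_pow_left₀ (by norm_num) ha 3
      norm_num at h; linarith
    have h2 : ((s : ℝ) / a) / a ^ 3 ≤ ((s : ℝ) / a) / 843 := div_le_div_of_nonneg_left hsa0.le (by norm_num) ha3
    rw [show 2 * (s : ℝ) / a ^ 4 = 2 * ((s : ℝ) / a ^ 4) by ring, h1]
    linarith
  · rw [le_div_iff₀ hR0, hc, hR]
    have h1 : (s : ℝ) / a ^ 2 ≤ A * (20 / 189) := by
      rw [pow_two, ← div_div]
      calc (s : ℝ) / a / a ≤ A / a := div_le_div_of_nonneg_right hsaA ha0.le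
        _ ≤ A / (189 / 20) := div_le_div_of_nonneg_left hApos.le (by norm_num) ha
        _ = A * (20 / 189) := by ring
    have h2 : (s : ℝ) / a ^ 3 ≤ A * (400 / 35721) := by
      rw [show (s : ℝ) / a ^ 3 = (s : ℝ) / a / a ^ 2 by rw [div_div, show a * a ^ 2 = a ^ 3 by ring]]
      calc (s : ℝ) / a / a ^ 2 ≤ A / a ^ 2 := div_le_div_of_nonneg_right hsaA (by positivity)
        _ ≤ A / (189 / 20) ^ 2 := div_le_div_of_nonneg_left hApos.le (by norm_num) (pow_le_pow_left₀ (by norm_num) ha 2)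
        _ = A * (400 / 35721) := by ring
    linarith
  · rw [div_le_iff₀ hR0]; linarith

/-- Numeric monomial bounds in `l = a/√s` and `μ = a·l` (all from `a²l ≤ 10⁻⁶`, `al ≤ 1.1·10⁻⁷`, `l ≤ 1.2·10⁻⁸`). -/
theorem monomials (s : ℕ) (hs : 4 * 10 ^ 18 ≤ s) {l : ℝ} (hl : l = xiMode (s : ℝ) / Real.sqrt s) :
    l ^ 2 ≤ 1.44e-16 ∧ l ^ 3 ≤ 1.8e-24 ∧ xiMode (s : ℝ) * l * l ≤ 1.4e-15 ∧
      xiMode (s : ℝ) * l * l ^ 2 ≤ 1.6e-23 ∧ xiMode (s : ℝ) * l * l ^ 3 ≤ 2e-31 ∧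
      xiMode (s : ℝ) ^ 2 * l * l ≤ 1.2e-14 ∧ xiMode (s : ℝ) ^ 2 * l * l ^ 2 ≤ 1.5e-22 ∧
      xiMode (s : ℝ) ^ 2 * l * l ^ 3 ≤ 1.8e-30 ∧ l ^ 2 * l ^ 2 ≤ 2.1e-32 ∧
      xiMode (s : ℝ) * l * l ^ 3 * l ≤ 2.4e-39 ∧ xiMode (s : ℝ) ^ 2 * l * l ^ 3 * l ≤ 2.2e-38 := by
  obtain ⟨ha0, _, _, _⟩ := mode_facts s hs
  obtain ⟨hl0, _, hmu2, hmu, hlb⟩ := scale_facts s hs hl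
  set a := xiMode (s : ℝ)
  have hal0 : 0 ≤ a * l := by positivity
  have ha2l0 : 0 ≤ a ^ 2 * l := by positivity
  have hl2 : l ^ 2 ≤ 1.44e-16 := by nlinarith
  have hl3 : l ^ 3 ≤ 1.8e-24 := by nlinarith
  have h1 : a * l * l ≤ 1.4e-15 := by nlinarith
  have h2 : a * l * l ^ 2 ≤ 1.6e-23 := by nlinarith
  have h3 : a * l * l ^ 3 ≤ 2e-31 := by nlinarith
  have h4 : a ^ 2 * l * l ≤ 1.2e-14 := by nlinarith
  have h5 : a ^ 2 * l * l ^ 2 ≤ 1.5e-22 := by nlinarith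
  have h6 : a ^ 2 * l * l ^ 3 ≤ 1.8e-30 := by nlinarith
  have h7 : l ^ 2 * l ^ 2 ≤ 2.1e-32 := by nlinarith
  have h8 : a * l * l ^ 3 * l ≤ 2.4e-39 := by nlinarith
  have h9 : a ^ 2 * l * l ^ 3 * l ≤ 2.2e-38 := by nlinarith
  exact ⟨hl2, hl3, h1, h2, h3, h4, h5, h6, h7, h8, h9⟩

end Summit.RiemannHypothesis.RiemannHypothesis.Theorems.JensenPolynomials.SkewFar

end
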